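import Literature.AlgebraicGeometry.HodgeTheory.StandardConjectureANondegeneratePairing
import Literature.AlgebraicGeometry.HodgeTheory.AbelianPencilFibreGysinNumericalLift
import Literature.AlgebraicGeometry.Abdulali1994.LefschetzStandardATransport
import Literature.AlgebraicGeometry.Abdulali1994.LefschetzStandardTransport
import Literature.AlgebraicGeometry.HodgeTheory.LefschetzStandardConjectureFacts
import Literature.AlgebraicGeometry.HodgeTheory.IsoTransport
import Literature.AlgebraicGeometry.Milne1999.LefschetzInvolutionIsLefschetz
import HarnessLib

/-!
# Abdulali 1994 (1.1): the Lefschetz standard conjecture for the total space transports algebraicity along a compact pencil of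
# abelian varieties — DISCHARGE of `Abdulali1994_invariantCycles_of_lefschetzStandard` and `…A`

Abdulali (Canad. J. Math. 46 (1994), p. 1122) / Milne (Hodge classes on abelian varieties, 2020, Prop. 1): for a compact pencil
`f : 𝒳 ⟶ S` of abelian `d`-folds whose total space satisfies Grothendieck's standard conjecture `A(𝒳, η)` for every polarisation
class (resp. `B(𝒳)` in the `⋆_L`-form), a rational class of the total space that is algebraic on one fibre is algebraic on every
fibre (`InvariantCyclesHoldFor f d`). The printed proof's inputs are theorems of the tree: Lieberman's `B(A)` for abelian varieties
(`HodgeTheory.Lieberman1968_lefschetzInvolution_algebraic_abelianVariety_holds`, Milne 1999 / Kleiman 2A11), `B ⇒ A` and `A ⇒ D`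
(layer 2), the Gysin numerical lift (layer 3) and the flatness of the local system (layer 1); the `θ`-splitting of the Leray
filtration in print is replaced by the fibrewise "hom ≡ num" argument.

* Part 1 — `abdulali_lefschetzStandard_of_standardConjectureA`: the `A`-form fact implies the `⋆_L`-form fact (`B ⇒ A` on the total space).
* Part 2 — `numerical_of_standardConjectureA` ((Num_t) from `A(𝒳)`), `nondegenerate_algebraicClasses_of_iso` ((Perf) is invariant
  under isomorphism), `forall_standardConjectureA_abelianVariety_of_lieberman`, `nondegenerate_fiberOver_of_lieberman` ((Perf_t) on every
  fibre from Lieberman), `invariantCyclesHoldFor_of_lieberman_of_standardConjectureA`, `abdulali1994A_of_lieberman`, `abdulali1994_of_lieberman`.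
* Part 3 — the discharges `Literature.AlgebraicGeometry.Abdulali1994.Abdulali1994_invariantCycles_of_lefschetzStandardA_holds` and
  `Literature.AlgebraicGeometry.Abdulali1994.Abdulali1994_invariantCycles_of_lefschetzStandard_holds` (Lieberman's theorem supplied).

Theorems only; no definition, no new named fact. Net named-fact debt −2. Nothing here asserts a case of the Hodge conjecture: these
are statements about transport of algebraicity under the standard conjecture `A` / `B` for the total space.

## References

* [Abdulali1994FamiliesAV] S. Abdulali, Algebraic cycles in families of abelian varieties, Canad. J. Math. 46 (1994), (1.1) and pp. 1122–1123.
* [Milne2020HodgeClassesAV] J. S. Milne, Hodge classes on abelian varieties (2020), Prop. 1 (p. 7).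
* [Lieberman1968] D. I. Lieberman, Numerical and homological equivalence of algebraic cycles on Hodge manifolds, Amer. J. Math. 90 (1968), main theorem.
* [Kleiman1968AlgebraicCycles] S. Kleiman, Algebraic cycles and the Weil conjectures (1968), §3 Cor. 3.9, Appendix Thm. 2A11.
* [Grothendieck1968] A. Grothendieck, Standard conjectures on algebraic cycles (Bombay 1968), §3 p. 196.
* [GrothendieckTopology1969] A. Grothendieck, Topology 8 (1969), §1.
* [HatcherAT2002] A. Hatcher, Algebraic Topology, §3.2 Prop. 3.10.

Provenance: Literature home (namespace `Literature.AlgebraicGeometry.HodgeTheory.AbelianPencil`) of the used declarations of the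
Summits-side `HodgeConjecture/Theorems/Ring2AbelianAllStandardAPencilsTransport (1/8)`, `…/Ring2AbelianAllAndreStandardALieberman (7/16)`
and the two discharges of `…/Ring2AbelianAllAndreLiebermanDischargedRows` (namespace `…Ring2.AbelianAll`; imports `Literature/` and
Mathlib only), re-homed so that the facts are discharged Literature-side under their exact names. Layer 4/4 (imports layers 2–3, `HodgeTheory/StandardConjectureANondegeneratePairing`,
`HodgeTheory/AbelianPencilFibreGysinNumericalLift`, and `Milne1999/LefschetzInvolutionIsLefschetz` for Lieberman's theorem).
-/

noncomputable section

namespace Literature.AlgebraicGeometry.HodgeTheory.AbelianPencil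

/-! ## Part 1: The `A`-form fact implies the `⋆_L`-form fact -/

section Part1

open _root_.CategoryTheory _root_.AlgebraicGeometry MonoidalCategory
open Literature.AlgebraicGeometry Literature.AlgebraicGeometry.Motives
open Literature.AlgebraicGeometry.HodgeTheory
open Literature.AlgebraicGeometry.Abdulali1994 (Abdulali1994_invariantCycles_of_lefschetzStandard Abdulali1994_invariantCycles_of_lefschetzStandardA)

/-! ## §D The new fact implies the old one -/

/-- **`h₈A ⟹ h₈`**: Abdulali's proposition with the hypothesis as printed (`A(𝒳, η)` for every polarisation class)
implies its `⋆_L`-form rendering (hypothesis `B(𝒳)`), by `B ⇒ A` on the total space (part XIV §0). The converse between the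
two facts is not claimed. [cite: Milne2020HodgeClassesAV, Prop. 1 (p. 7)] [cite: Grothendieck1968, §3 p. 196 (B(X) ⇒ A(X))] -/
theorem abdulali_lefschetzStandard_of_standardConjectureA (h : Abdulali1994_invariantCycles_of_lefschetzStandardA) :
    Abdulali1994_invariantCycles_of_lefschetzStandard :=
  fun _ _ _ f hf hB ↦
    h f hf (forall_standardConjectureA_of_forall_standardConjectureBStar hf.isSmoothProjective_total hB)

end Part1

/-! ## Part 2: (Num) from `A(𝒳)`, (Perf) on the fibres from Lieberman's theorem; Abdulali's (1.1) modulo Lieberman -/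

section Part2

open _root_.CategoryTheory _root_.AlgebraicGeometry
open Literature.AlgebraicGeometry Literature.AlgebraicGeometry.Motives
open Literature.AlgebraicGeometry.HodgeTheory
open Literature.AlgebraicTopology.SingularHomology (cupProduct cupProduct_map)
open Literature.AlgebraicGeometry.Abdulali1994 (InvariantCyclesHoldFor Abdulali1994_invariantCycles_of_lefschetzStandardA Abdulali1994_invariantCycles_of_lefschetzStandard)

/-! ## §0 Compact pencils: (Num) from `A(𝒳)`, (Perf) from `A(𝒳_t)`; the Lefschetz-`A` rows without `h₈A` -/

section Rows

variable {𝒳 S : SchemeOver ℂ}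

/-- **(Num_t) from `A(𝒳, η)`**: if `A` holds for the `(d+1)`-dimensional TOTAL SPACE of a compact pencil (for every
polarisation class), then for every `t` and `p + q = d`, an algebraic class `j_{t*} b` (`b ∈ N^q(𝒳_t)`) cup-orthogonal to
`N^p(𝒳)` vanishes (`D(𝒳)` in bidegree `(p, q+1)`, §3). [cite: Kleiman1968AlgebraicCycles, §3 Cor. 3.9]
[cite: Milne2020HodgeClassesAV, Prop. 1 (p. 7)] -/
theorem numerical_of_standardConjectureA {d : ℕ} {f : 𝒳 ⟶ S} (hf : IsCompactAbelianPencil f d) (t : ComplexPoints S)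
    {p q : ℕ} (hpq : p + q = d)
    (hA : ∀ η : complexBetti 𝒳 2, IsPolarizationClass (d + 1) 𝒳 η → StandardConjectureA (d + 1) 𝒳 η) :
    ∀ b ∈ algebraicClasses (fiberOver f t) q,
      (∀ a ∈ algebraicClasses 𝒳 p,
        cupProduct (show 2 * p + 2 * (q + 1) = 2 * (d + 1) by omega) a (fiberGysin hf t q b) = 0) →
        fiberGysin hf t q b = 0 :=
  fun b hb hab ↦ (nondegenerate_algebraicClasses_of_standardConjectureA hf.isSmoothProjective_total hA
    (show p + (q + 1) = d + 1 by omega)).2 (fiberGysin hf t q b) (fiberGysin_mem_algebraicClasses hf t hb) hab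

end Rows

/-! ## §1 Transport of (Perf) along an isomorphism -/

section Iso

variable {n : ℕ} {Y Y' : SchemeOver ℂ}

/-- **(Perf) is invariant under isomorphism**: if the cup pairing `N^p(Y) × N^q(Y) → H^{2n}` is non-degenerate on both sides
then so is `N^p(Y') × N^q(Y') → H^{2n}` for `e : Y ≅ Y'` (pull-backs along `e`, `e⁻¹` exchange the algebraic classes —
the tree's `mem_algebraicClasses_map_iff_of_iso` — and are multiplicative). [cite: GrothendieckTopology1969, §1]
[cite: HatcherAT2002, §3.2 Prop. 3.10] -/
theorem nondegenerate_algebraicClasses_of_iso (e : Y ≅ Y') {p q : ℕ} (hpq : p + q = n)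
    (h : (∀ ξ ∈ algebraicClasses Y p,
        (∀ b ∈ algebraicClasses Y q, cupProduct (show 2 * p + 2 * q = 2 * n by omega) ξ b = 0) → ξ = 0) ∧
      (∀ b ∈ algebraicClasses Y q,
        (∀ ξ ∈ algebraicClasses Y p, cupProduct (show 2 * p + 2 * q = 2 * n by omega) ξ b = 0) → b = 0)) :
    (∀ ξ ∈ algebraicClasses Y' p,
        (∀ b ∈ algebraicClasses Y' q, cupProduct (show 2 * p + 2 * q = 2 * n by omega) ξ b = 0) → ξ = 0) ∧
      (∀ b ∈ algebraicClasses Y' q,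
        (∀ ξ ∈ algebraicClasses Y' p, cupProduct (show 2 * p + 2 * q = 2 * n by omega) ξ b = 0) → b = 0) := by
  obtain ⟨h₁, h₂⟩ := h
  have hcup : ∀ (ξ' : complexBetti Y' (2 * p)) (b' : complexBetti Y' (2 * q)),
      complexBetti.map e.hom (2 * n) (cupProduct (show 2 * p + 2 * q = 2 * n by omega) ξ' b') =
        cupProduct (show 2 * p + 2 * q = 2 * n by omega) (complexBetti.map e.hom (2 * p) ξ')
          (complexBetti.map e.hom (2 * q) b') :=
    fun ξ' b' ↦ cupProduct_map (AlgPoints.mapContinuous (L := ℂ) e.hom) _ ξ' b'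
  refine ⟨fun ξ' hξ' hb' ↦ ?_, fun b' hb' hξ' ↦ ?_⟩
  · have hξ : complexBetti.map e.hom (2 * p) ξ' ∈ algebraicClasses Y p := (mem_algebraicClasses_map_iff_of_iso e).2 hξ'
    have h0 : complexBetti.map e.hom (2 * p) ξ' = 0 := by
      refine h₁ _ hξ fun b hb ↦ ?_
      have hb'' : complexBetti.map e.inv (2 * q) b ∈ algebraicClasses Y' q :=
        (mem_algebraicClasses_map_iff_of_iso e.symm).2 hb
      rw [← e.complexBetti_map_hom_map_inv (2 * q) b, ← hcup, hb' _ hb'', map_zero]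
    rw [← e.complexBetti_map_inv_map_hom (2 * p) ξ', h0, map_zero]
  · have hb : complexBetti.map e.hom (2 * q) b' ∈ algebraicClasses Y q := (mem_algebraicClasses_map_iff_of_iso e).2 hb'
    have h0 : complexBetti.map e.hom (2 * q) b' = 0 := by
      refine h₂ _ hb fun ξ hξ ↦ ?_
      have hξ'' : complexBetti.map e.inv (2 * p) ξ ∈ algebraicClasses Y' p :=
        (mem_algebraicClasses_map_iff_of_iso e.symm).2 hξ
      rw [← e.complexBetti_map_hom_map_inv (2 * p) ξ, ← hcup, hξ' _ hξ'', map_zero]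
    rw [← e.complexBetti_map_inv_map_hom (2 * q) b', h0, map_zero]

end Iso

/-! ## §2 Lieberman's theorem gives `D` on the fibres of a compact abelian pencil -/

/-- **`B(A) ⇒ A(A, η)` for every abelian variety and every polarisation class** (Lieberman's fact in the tree's
`⋆_L`-form, then seat ab-andre-1's `standardConjectureA_of_standardConjectureBStar`). [cite: Lieberman1968, main theorem]
[cite: Grothendieck1968, §3 p. 196 (B(X) ⇒ A(X))] -/
theorem forall_standardConjectureA_abelianVariety_of_lieberman (hL : Lieberman1968_lefschetzInvolution_algebraic_abelianVariety)
    (A : AbelianVariety ℂ) :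
    ∀ η : complexBetti A.X 2, IsPolarizationClass A.dim A.X η → StandardConjectureA A.dim A.X η :=
  fun η hη ↦ standardConjectureA_of_standardConjectureBStar AbelianVariety.isSmoothProjective_holds hη (hL A η)

variable {𝒳 S : SchemeOver ℂ}

/-- **(Perf_t) at EVERY fibre of a compact pencil of abelian varieties, granted Lieberman's theorem**: the fibre is
`≅ A.X` for an abelian variety `A` of dimension `d`, `A(A.X, η)` holds for the Kähler class of a Kähler–rational datum
(Lieberman + `B ⇒ A`), so `D(A.X)` in every bidegree (part XVIII-d, Kleiman), transported along the isomorphism.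
[cite: Lieberman1968, main theorem] [cite: Kleiman1968AlgebraicCycles, §3 Cor. 3.9] -/
theorem nondegenerate_fiberOver_of_lieberman (hL : Lieberman1968_lefschetzInvolution_algebraic_abelianVariety)
    {d : ℕ} {f : 𝒳 ⟶ S} (hf : IsCompactAbelianPencil f d) (t : ComplexPoints S) {p q : ℕ} (hpq : p + q = d) :
    (∀ ξ ∈ algebraicClasses (fiberOver f t) p,
        (∀ b ∈ algebraicClasses (fiberOver f t) q, cupProduct (show 2 * p + 2 * q = 2 * d by omega) ξ b = 0) → ξ = 0) ∧
      (∀ b ∈ algebraicClasses (fiberOver f t) q,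
        (∀ ξ ∈ algebraicClasses (fiberOver f t) p, cupProduct (show 2 * p + 2 * q = 2 * d by omega) ξ b = 0) → b = 0) := by
  obtain ⟨A, ⟨e⟩⟩ := hf.exists_abelianVariety_fiber t
  have hdim : A.dim = d := Andre1996.compactPencil_dim_eq_of_iso hf e
  have hND := nondegenerate_algebraicClasses_of_standardConjectureA (AbelianVariety.isSmoothProjective_holds (A := A))
    (forall_standardConjectureA_abelianVariety_of_lieberman hL A) (p := p) (q := q) (by omega)
  subst hdim
  exact nondegenerate_algebraicClasses_of_iso e hpq hND

/-! ## §3 One pencil, the facts, the nodes -/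

/-- **`A(𝒳) ⇒ (1.1)_f` for one compact pencil, granted Lieberman's theorem** ((Num) from `A(𝒳)`, part XVIII-d; (Perf) on
every fibre from Lieberman, §2; the lift and the flatness, part XVIII-a). [cite: Abdulali1994FamiliesAV, p. 1122 and (1.1)]
[cite: Milne2020HodgeClassesAV, Prop. 1 (p. 7)] [cite: Lieberman1968, main theorem] -/
theorem invariantCyclesHoldFor_of_lieberman_of_standardConjectureA
    (hL : Lieberman1968_lefschetzInvolution_algebraic_abelianVariety) {d : ℕ} {f : 𝒳 ⟶ S} (hf : IsCompactAbelianPencil f d)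
    (hA : ∀ η : complexBetti 𝒳 2, IsPolarizationClass (d + 1) 𝒳 η → StandardConjectureA (d + 1) 𝒳 η) :
    InvariantCyclesHoldFor f d :=
  invariantCyclesHoldFor_of_nondegenerate_of_numerical hf fun t _ _ hpq ↦
    ⟨(nondegenerate_fiberOver_of_lieberman hL hf t hpq).1, (nondegenerate_fiberOver_of_lieberman hL hf t hpq).2,
      numerical_of_standardConjectureA hf t hpq hA⟩

/-- **THE ABDULALI FACT WITH PRINT'S HYPOTHESIS IS A THEOREM MODULO LIEBERMAN:
`Lieberman1968_lefschetzInvolution_algebraic_abelianVariety → Abdulali1994_invariantCycles_of_lefschetzStandardA`.**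
The named fact `h₈A` (Abdulali 1994 p. 1122 / Milne 2020 Prop. 1, hypothesis `A(𝒳, η)`) of seat ab-andre-1's part XIV-b
needs no citation of its own: its printed proof's inputs — Lieberman on the fibres, Poincaré duality, Gysin functoriality,
flatness of the local system — are in the tree, the `θ_n`-splitting of the Leray filtration being replaced by the
fibrewise "hom ≡ num" argument of parts XVIII-a/d. [cite: Abdulali1994FamiliesAV, p. 1122] [cite: Milne2020HodgeClassesAV, Prop. 1 (p. 7)]
[cite: Lieberman1968, main theorem] [cite: Kleiman1968AlgebraicCycles, §3 Cor. 3.9] -/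
theorem abdulali1994A_of_lieberman (hL : Lieberman1968_lefschetzInvolution_algebraic_abelianVariety) :
    Abdulali1994_invariantCycles_of_lefschetzStandardA :=
  fun _ _ _ _ hf hA ↦ invariantCyclesHoldFor_of_lieberman_of_standardConjectureA hL hf hA

/-- **… and so is the `⋆_L`-form fact `h₈` of seat ab-andre-1's part II** (`h₈A ⟹ h₈`, part XIV-b).
[cite: Abdulali1994FamiliesAV, p. 1122] [cite: Grothendieck1968, §3 p. 196 (B(X) ⇒ A(X))] -/
theorem abdulali1994_of_lieberman (hL : Lieberman1968_lefschetzInvolution_algebraic_abelianVariety) :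
    Abdulali1994_invariantCycles_of_lefschetzStandard :=
  abdulali_lefschetzStandard_of_standardConjectureA (abdulali1994A_of_lieberman hL)

end Part2

/-! ## Part 3: The discharges -/

section Part3

open _root_.CategoryTheory Literature.AlgebraicGeometry.Motives Literature.AlgebraicGeometry.HodgeTheory
open Literature.AlgebraicGeometry.Abdulali1994 (InvariantCyclesHoldFor Abdulali1994_invariantCycles_of_lefschetzStandard
  Abdulali1994_invariantCycles_of_lefschetzStandardA)

/-- **DISCHARGE of the named fact `Abdulali1994_invariantCycles_of_lefschetzStandardA`** (Abdulali 1994 p. 1122 in the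
`A`-form; Milne 2020 Prop. 1): `abdulali1994A_of_lieberman` with Lieberman's theorem — the Literature THEOREM
`HodgeTheory.Lieberman1968_lefschetzInvolution_algebraic_abelianVariety_holds` — supplied.
[cite: Abdulali1994FamiliesAV, (1.1) p. 1122 and pp. 1122–1123] [cite: Milne2020HodgeClassesAV, Prop. 1 (p. 7)]
[cite: Lieberman1968, main theorem] -/
theorem _root_.Literature.AlgebraicGeometry.Abdulali1994.Abdulali1994_invariantCycles_of_lefschetzStandardA_holds :
    Abdulali1994_invariantCycles_of_lefschetzStandardA :=
  abdulali1994A_of_lieberman Lieberman1968_lefschetzInvolution_algebraic_abelianVariety_holds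

/-- **DISCHARGE of the named fact `Abdulali1994_invariantCycles_of_lefschetzStandard`** (Abdulali 1994 p. 1122, hypothesis
`B(𝒳)` in the `⋆_L`-form; Milne 2020 Prop. 1): `abdulali1994_of_lieberman` with Lieberman's theorem supplied.
[cite: Abdulali1994FamiliesAV, (1.1) p. 1122 and pp. 1122–1123] [cite: Milne2020HodgeClassesAV, Prop. 1 (p. 7)]
[cite: Lieberman1968, main theorem] -/
theorem _root_.Literature.AlgebraicGeometry.Abdulali1994.Abdulali1994_invariantCycles_of_lefschetzStandard_holds :
    Abdulali1994_invariantCycles_of_lefschetzStandard :=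
  abdulali1994_of_lieberman Lieberman1968_lefschetzInvolution_algebraic_abelianVariety_holds

/-- Unfolded at one pencil: `A(𝒳, η)` for every polarisation class of the total space of a compact pencil of abelian `d`-folds
gives Abdulali's (1.1) for that pencil, with no hypothesis left. [cite: Abdulali1994FamiliesAV, (1.1) p. 1122] -/
theorem invariantCyclesHoldFor_of_standardConjectureA {𝒳 S : SchemeOver ℂ} {d : ℕ} {f : 𝒳 ⟶ S}
    (hf : IsCompactAbelianPencil f d)
    (hA : ∀ η : complexBetti 𝒳 2, IsPolarizationClass (d + 1) 𝒳 η → StandardConjectureA (d + 1) 𝒳 η) :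
    InvariantCyclesHoldFor f d :=
  invariantCyclesHoldFor_of_lieberman_of_standardConjectureA Lieberman1968_lefschetzInvolution_algebraic_abelianVariety_holds
    hf hA

end Part3

end Literature.AlgebraicGeometry.HodgeTheory.AbelianPencil

end
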